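import Summits.ValiantsHypothesis.ValiantsHypothesis.Theses.DetQP
import Summits.ValiantsHypothesis.ValiantsHypothesis.Theses.UlrichPadded
import Literature.Computability.AlgebraicComplexity.Hyperdeterminant
import Literature.Computability.AlgebraicComplexity.Apolarity
import Literature.Computability.AlgebraicComplexity.OrbitClosureProofs
import Literature.Computability.AlgebraicComplexity.DeterminantalComplexityProofs
import Literature.Computability.AlgebraicComplexity.ValiantCompleteness
import Literature.Computability.AlgebraicComplexity.VPDeterminantalQPProofs
import Summits.ValiantsHypothesis.ValiantsHypothesis.Theorems.DetQPDetqpThesisStubIsVNPFamilyHyperdet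
import Summits.ValiantsHypothesis.ValiantsHypothesis.Theorems.DetQPDetqpThesisStubSequentialApolarity
import Summits.ValiantsHypothesis.ValiantsHypothesis.Theorems.DetQPDetqpThesisStubStabH
import Summits.ValiantsHypothesis.ValiantsHypothesis.Theorems.DetQPDetqpThesisStubTorusLimitGeneral
import Summits.ValiantsHypothesis.ValiantsHypothesis.Theorems.DetQPDetqpThesisStubBorelFixedOfParts
import Summits.ValiantsHypothesis.ValiantsHypothesis.Theorems.DetQPDetqpThesisStubBorderFloor
import Summits.ValiantsHypothesis.ValiantsHypothesis.Theorems.DetQPDetqpThesisHyperdetWeightH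

/-!
# Line `four-dimensional-determinant` — skeleton for crux `DetQP.DetqpThesis`
# (stmt-ValiantsHypothesis-0315; decls `DetQP.DetqpThesis` = `UlrichPadded.Target` =
# `ScaledPencil.DcPerNotQP`, literally the same term), lead reshaping v4 (2026-08-16, lead
# prover-line-stmt-ValiantsHypothesis-0315-c2-0; v3 by lead -1/c1) of the crux-plan skeleton
# `Cruxes/DetqpThesis/Lines/four_dimensional_determinant.lean`.

**State (v4).** Every stub of the line is LANDED except the bet C₂ (`stub_noFixedWitnessQP_high`,
the ONLY `sorry` of this file): A `stub_isVNPFamily_hyperdet` (p87809), B1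
`stub_sequentialApolarity`, B2w `HdBorelFixed.hd_weightH` (p102207, plugged in v4), B2s
`stub_stabH`, B2t `stub_torusLimit_general`, B2d `stub_borelFixed_of_parts` (p99172), C₁
`stub_borderFloor` (p102403).  Calibration of the bet (lead c1, `Cruxes/DetqpThesis/CALIBRATION-c1.md`,
kernel-checked): with C₁ landed, C₂ ⇔ C (the crux-plan's whole-window stub) ⇔
`GCTMult.GctThesis` (crux stmt-ValiantsHypothesis-0323) — `HdCalibration.hd_noFixedWitnessQP_iff_gctThesis`
(Theorems/DetQPDetqpThesisHyperdetCalibrationEquiv.lean, p115783) and, for the registered C₂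
verbatim, `HdCalibration.hd_noFixedWitnessQP_high_iff_gctThesis` (lead c2).  So this skeleton closes
the crux modulo EXACTLY crux 0323; C₂ is crux-sized (promote / identify with 0323).

**Crux (fixed).** `X := ¬ IsQPBounded (n ↦ dc(per_n / ℂ))`.

**Idea (card `Ideas/four-dimensional-determinant.md`; triage r1: pass × 2).** Swap the permanent
for the four-dimensional determinant `H_n := hyperdet (X_I)_{I : Fin 4 → Fin n}` (Cayley's first
hyperdeterminant of the generic `n×n×n×n` array, the tree's
`Literature.Computability.AlgebraicComplexity.hyperdet`).  `H ∈ VNP` (stub A, LANDED: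
`Theorems.DetQPDetqpThesis.stub_isVNPFamily_hyperdet`, p87809) and `per` is `VNP`-complete
(`isVNPComplete_perPoly_holds`), so `X_H := ¬ IsQPBounded (n ↦ dc(H_n))` implies `X` (transfer,
PROVED below); `X_H` is attacked by Borel-fixed border apolarity with the connected solvable group
`H(n,m,ι) ⊆ Stab(X₀₀^{m-n} H_n(X_ι))` built from four Borels `B_n` (one per tensor slot), the
padding torus and the triangular group of the unused variables.

**Shape (v3, kept in v4).** Registered stubs, `sorry` only inside `stub_*`, every stub stated over Mathlib +
`Literature.*` declarations only:
* `stub_sequentialApolarity` (B1, TRUE, S given the tree: `bfba_extract` + continuity) — necessity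
  half of border apolarity for `Δ(det_m)` and an ARBITRARY target `Q`;
* `stub_weightH` (B2w, LANDED as `hd_weightH`, here `weightH_landed`) — a generic anti-dominant cocharacter `μ` of the torus of
  `H(n,m,ι)`: `μ ≥ 0`, injective, index-lowering inside the used block and the moves of the unused
  variables LOWER `μ`, the padded `H_n` is `μ`-homogeneous, and equal `μ`-weight in degree `≤ m`
  forces equal character for every diagonal element of `H` (digits in base `m+2`);
* `stub_stabH` (B2s, TRUE, M) — `H(n,m,ι)` fixes `X₀₀^{m-n} H_n(X_ι)` (`hyperdet_slotMul`);
* `stub_torusLimit_general` (B2t, TRUE, M) — the torus limit `J ↦ in_μ(J)` keeps the limit set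
  `Y_f` for ANY `μ`-homogeneous target `f` (the tree's `bfba_torusLimit`, which is written for
  the padded permanent only);
* `stub_borelFixed_of_parts` (B2d, TRUE, L) — B2 from B2w + B2s + B2t: translate / torus-limit /
  potential DESCENT over the unipotent class `{V : V unit lower-triangular, Vᵀ ∈ H}` / W4, exactly
  as the LANDED per-analogue `Theorems.BorderApolarityBorelFixedBorderApolarity.bfba_descent`,
  `bfba_W4_of_graded_of_unipotent`, `BorelFixedBorderApolarity_proof` (route BorderApolarity,
  item 5781, closed);
* `stub_borderFloor` (C₁, TRUE, provable now) — `X₀₀^{m-n} H_n(X_ι) ∉ Δ(det_m)` for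
  `3 ≤ n ≤ m`, `2m < n⁴` (Landsberg–Manivel–Ressayre invariant at the block-embedded
  Mignon–Ressayre point: the BORDER upgrade `\underline{dc}(H_n) ≥ n⁴/2` of the landed affine
  floor), i.e. stub C on the polynomial part of the window;
* `stub_noFixedWitnessQP_high` (C₂, THE BET; open-problem grade) — in the upper part
  `n⁴/2 ≤ m ≤ 2^{(log₂ n + c)^c}` of the window there is no `H(n,m,ι)`-stable witness.
Compositions (no `sorry`): `borelFixedWitness` (= the crux-plan's stub B2, now DERIVED from
B2w/B2s/B2t/B2d), `hyperdet_not_mem_orbitClosure_qp` (C₁ below `n⁴/2`; B1+B2+C₂ above), `not_isQPBounded_dc_hyperdet`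
(`X_H`), `detqpThesis_of_transfer` (A ⇒ (`X_H → X`)), `DetqpThesis_of : DetQP.DetqpThesis`,
`Target_of : UlrichPadded.Target`.

**Disproof used** (`Cruxes/DetqpThesis/Disproof.lean`, cdisprove, re-read 2026-08-16T10:20Z,
53716 B, sorry-free; the crux has NO hypotheses, so there is no `_false_without_` theorem, no
`-- Targets` section; landed `Theorems/DetqpThesis/Negative/*` are variants (A)–(G), none about a
stub of this line): (A) char ≠ 2 consumed in `detqpThesis_of_transfer`; (B) the per-specific input
is `VNP`-completeness, used once; (E)/(F) the transfer has the shape of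
`not_isQPBounded_of_eventually_le` / `qpBound_comp_le`; (C)/(D) no stub asserts super-Grenet
growth, Grenet-optimality or a template constant `c ≤ 1`.
-/

set_option linter.unusedVariables false
set_option linter.dupNamespace false

namespace Summit.ValiantsHypothesis.ValiantsHypothesis.Cruxes.DetqpThesis.FourDimensionalDeterminant

open MvPolynomial
open scoped BigOperators Matrix
open Literature.Computability.AlgebraicComplexity

noncomputable section

/-! ## Stub A — LANDED -/

/-- **A (landed, p87809)** — the four-dimensional determinant family is in `VNP` over `ℂ`. -/
theorem hyperdet_isVNP :
    IsVNPFamily (k := ℂ)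
      (fun n => hyperdet fun I : Fin 4 → Fin n => (X I : MvPolynomial (Fin 4 → Fin n) ℂ)) :=
  Summit.ValiantsHypothesis.ValiantsHypothesis.Theorems.DetQPDetqpThesis.stub_isVNPFamily_hyperdet

/-! ## The registered stubs -/

/-- **Stub B1 (TRUE) — sequential border apolarity for `Δ(det_m)`, necessity half, for an
arbitrary target.**  If `Q ∈ Δ(det_m) = \overline{GL_{m²}·det_m}` then there are translates
`P_t ∈ GL·det_m` and a family `J = (J_k)_k` which is, degree by degree for `k ≤ m`, the Kuratowski
limit of the annihilator spaces `Ann_k(P_t)` (`IsBorderApolarLimit m P J`), with `J_k ⊆ Ann_k(Q)`.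
Why true / how: Zariski closure of the orbit = Euclidean closure
(`orbitClosure_eq_euclidean_closure_complex_holds`; `Q` is a form of degree `m` because the forms of
degree `m` are a Zariski closed set containing the orbit), so `g_t·det_m → Q` coefficientwise;
`Theorems.BorderApolarityBorelFixedBorderApolarity.bfba_extract` (target-agnostic) extracts a
subsequence along which every `Ann_k`, `k ≤ m`, Kuratowski-converges; the limit annihilates `Q` by
`bfba_tendsto_apolarAction`.  (`Q = 0` is allowed and harmless.)  [BuczynskaBuczynski2021 Thm 1
(necessity); LandsbergGCT2017 §10.1.2] -/
theorem sequentialApolarity_landed {m : ℕ} (Q : MvPolynomial (Fin m × Fin m) ℂ)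
    (hQ : Q ∈ orbitClosure (detPoly (Fin m) ℂ)) :
    ∃ (P : ℕ → MvPolynomial (Fin m × Fin m) ℂ) (J : ℕ → Set (MvPolynomial (Fin m × Fin m) ℂ)),
      (∀ t : ℕ, P t ∈ glOrbit (Fin m × Fin m) ℂ (detPoly (Fin m) ℂ)) ∧
      IsBorderApolarLimit m P J ∧
      (∀ k ≤ m, ∀ D ∈ J k, apolarAction D Q = 0) :=
  Summit.ValiantsHypothesis.ValiantsHypothesis.Theorems.DetQPDetqpThesis.stub_sequentialApolarity Q hQ

/-- **Stub B2w (LANDED p102207 as `Theorems.DetQPDetqpThesis.HdBorelFixed.hd_weightH`) — a generic anti-dominant cocharacter of the torus of `H(n,m,ι)`.**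
For an injective placement `ι` of the `n⁴` array variables missing the padding variable `(0,0)`
there is an integer weight `μ` on the `m²` matrix variables with: (0) `μ ≥ 0`; (1) `μ` injective;
(2) anti-dominance — (i) lowering a multi-index inside the used block raises `μ`
(`I' ≤ I`, `I' ≠ I ⇒ μ(ιI) < μ(ιI')`), (ii) unused variables weigh less than used ones and than
the padding variable, (iii) on the unused variables `μ` decreases along the order `p.1·m + p.2`;
(3) the padded hyperdeterminant `X₀₀^{m-n} H_n(X_ι)` is `μ`-homogeneous; (4) genericity — two
exponents of degree `≤ m` with the same `μ`-weight have the same character `∏_v d_v^{e_v}` for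
every nowhere-zero `d` of `H`-diagonal shape (`d(ιI) = ∏_r t_r(I_r)`); (5) weights of exponents
of degree `≤ m` are bounded.  How: base `R = m + 2`; unused `p ↦ R^{m²-1-(p.1 m + p.2)}`, used
`ιI ↦ Σ_{r<4} R^{m² + r n + (n-1-I_r)}`, padding `↦ R^{m² + 4n}`; the `μ`-weight of an exponent of
degree `≤ m` is a base-`R` numeral whose digits are (unused exponents, the four slot contents
`A_{r,i}(e) = Σ_{I : I_r = i} e(ιI)`, padding exponent), cf. the per-analogue
`Theorems.BorderApolarityBorelFixedBorderApolarity.bfba_exists_weight` (WeightsA/WeightsB).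
[folklore; ConnerHarperLandsberg2023 §2.4] -/
theorem weightH_landed (n m : ℕ) [NeZero m]
    (ι : (Fin 4 → Fin n) → Fin m × Fin m) (hι : Function.Injective ι)
    (hℓ : ((0 : Fin m), (0 : Fin m)) ∉ Set.range ι) :
    ∃ μ : Fin m × Fin m → ℤ,
      (∀ v, 0 ≤ μ v) ∧
      Function.Injective μ ∧
      (∀ I I' : Fin 4 → Fin n, (∀ r, I' r ≤ I r) → I ≠ I' → μ (ι I) < μ (ι I')) ∧
      (∀ p : Fin m × Fin m, p ∉ Set.range ι → p ≠ (0, 0) → ∀ I : Fin 4 → Fin n, μ p < μ (ι I)) ∧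
      (∀ p : Fin m × Fin m, p ∉ Set.range ι → p ≠ (0, 0) → μ p < μ (0, 0)) ∧
      (∀ p q : Fin m × Fin m, p ∉ Set.range ι → p ≠ (0, 0) → q ∉ Set.range ι → q ≠ (0, 0) →
        (p.1 : ℕ) * m + (p.2 : ℕ) < (q.1 : ℕ) * m + (q.2 : ℕ) → μ q < μ p) ∧
      (∃ ν₀ : ℤ, ∀ d ∈ (X ((0 : Fin m), (0 : Fin m)) ^ (m - n) *
          rename ι (hyperdet fun I : Fin 4 → Fin n => (X I : MvPolynomial (Fin 4 → Fin n) ℂ))).support,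
        Finsupp.weight μ d = ν₀) ∧
      (∀ e e' : Fin m × Fin m →₀ ℕ, e.degree ≤ m → e'.degree ≤ m →
        Finsupp.weight μ e = Finsupp.weight μ e' →
        ∀ d : Fin m × Fin m → ℂ, (∀ v, d v ≠ 0) →
          (∃ t : Fin 4 → Fin n → ℂ, ∀ I : Fin 4 → Fin n, d (ι I) = ∏ r, t r (I r)) →
          ∏ v ∈ e.support, d v ^ e v = ∏ v ∈ e'.support, d v ^ e' v) ∧
      (∃ hi : ℤ, ∀ e : Fin m × Fin m →₀ ℕ, e.degree ≤ m → Finsupp.weight μ e ≤ hi) :=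
  Summit.ValiantsHypothesis.ValiantsHypothesis.Theorems.DetQPDetqpThesis.HdBorelFixed.hd_weightH n m ι hι hℓ

/-- **Stub B2s (TRUE) — `H(n,m,ι)` stabilises the padded four-dimensional determinant.**  A
substitution `M` whose used columns are a Kronecker product of four upper triangular matrices
`a_0, …, a_3` (`X_{ιI} ↦ Σ_{I'} (∏_r a_r(I'_r, I_r)) X_{ιI'}`), whose padding column is
`X₀₀ ↦ λ X₀₀`, and with `λ^{m-n} ∏_r ∏_i a_r(i,i) = 1`, fixes `X₀₀^{m-n} H_n(X_ι)`: the
substitution acts on the array slot by slot, `hyperdet (M ⋆_r A) = det M · hyperdet A`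
(`hyperdet_slotMul`, GKZ Ch. 14 Prop. 1.4) and `det a_r = ∏_i a_r(i,i)`
(`Matrix.det_of_upperTriangular`).  [folklore] -/
theorem stabH_landed (n m : ℕ) [NeZero m]
    (ι : (Fin 4 → Fin n) → Fin m × Fin m) (hι : Function.Injective ι)
    (hℓ : ((0 : Fin m), (0 : Fin m)) ∉ Set.range ι)
    (M : Matrix (Fin m × Fin m) (Fin m × Fin m) ℂ)
    (h1 : ∃ a : Fin 4 → Matrix (Fin n) (Fin n) ℂ,
        (∀ (r : Fin 4) (i j : Fin n), j < i → a r i j = 0) ∧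
        (∀ I I' : Fin 4 → Fin n, M (ι I') (ι I) = ∏ r, a r (I' r) (I r)) ∧
        M (0, 0) (0, 0) ^ (m - n) * ∏ r, ∏ i, a r i i = 1)
    (h2 : ∀ (I : Fin 4 → Fin n) (p : Fin m × Fin m), p ∉ Set.range ι → M p (ι I) = 0)
    (h3 : ∀ p : Fin m × Fin m, p ≠ (0, 0) → M p (0, 0) = 0) :
    linSubst (Fin m × Fin m) ℂ M
        (X ((0 : Fin m), (0 : Fin m)) ^ (m - n) *
          rename ι (hyperdet fun I : Fin 4 → Fin n => (X I : MvPolynomial (Fin 4 → Fin n) ℂ))) =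
      X ((0 : Fin m), (0 : Fin m)) ^ (m - n) *
        rename ι (hyperdet fun I : Fin 4 → Fin n => (X I : MvPolynomial (Fin 4 → Fin n) ℂ)) :=
  Summit.ValiantsHypothesis.ValiantsHypothesis.Theorems.DetQPDetqpThesis.stub_stabH n m ι hι hℓ M h1 h2 h3

/-- **Stub B2t (TRUE) — torus limits stay in the limit set, for any weighted-homogeneous
target.**  Let `J` be the degree-wise (`k ≤ m`) Kuratowski limit of `Ann(P_t)` along
`P_t ∈ GL · det_m` with `J_k ⌟ f = 0`, and let `μ` be an integer weight making `f` weighted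
homogeneous.  Then the INITIAL SPAN `in_μ(J) = (span of the lowest-`μ`-weight components of the
elements of J_k)_k` is again such a limit (along torus translates `diag((s+2)^μ) · P_{τ(s)}`)
inside `Ann(f)`.  This is VERBATIM the tree's
`Theorems.BorderApolarityBorelFixedBorderApolarity.bfba_torusLimit` (300 lines, diagonal argument:
`tli_exists_approx`, `cellRetraction_coeff_ls_of_li`, `bfba_linSubst_torus_of_weight`) with the
padded permanent replaced by a general `f` — the target enters that proof only through the
weighted homogeneity `hμ` (its lines 281–292).  [folklore] -/
theorem torusLimit_general_landed {m : ℕ} (f : MvPolynomial (Fin m × Fin m) ℂ)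
    (P : ℕ → MvPolynomial (Fin m × Fin m) ℂ)
    (hP : ∀ t, P t ∈ glOrbit (Fin m × Fin m) ℂ (detPoly (Fin m) ℂ))
    (J : ℕ → Set (MvPolynomial (Fin m × Fin m) ℂ)) (hJ : IsBorderApolarLimit m P J)
    (hJf : ∀ k ≤ m, ∀ D ∈ J k, apolarAction D f = 0)
    (μ : Fin m × Fin m → ℤ) (ν₀ : ℤ)
    (hμ : ∀ d ∈ f.support, Finsupp.weight μ d = ν₀) :
    ∃ (P' : ℕ → MvPolynomial (Fin m × Fin m) ℂ) (J' : ℕ → Set (MvPolynomial (Fin m × Fin m) ℂ)),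
      (∀ t, P' t ∈ glOrbit (Fin m × Fin m) ℂ (detPoly (Fin m) ℂ)) ∧ IsBorderApolarLimit m P' J' ∧
      (∀ k ≤ m, ∀ D ∈ J' k, apolarAction D f = 0) ∧
      (∀ k, ∀ D, D ∈ J' k ↔ D ∈ Submodule.span ℂ {D' : MvPolynomial (Fin m × Fin m) ℂ |
          ∃ E ∈ J k, ∃ ν : ℤ, D' = weightedHomogeneousComponent μ ν E ∧
            ∀ ν' : ℤ, ν' < ν → weightedHomogeneousComponent μ ν' E = 0}) :=
  Summit.ValiantsHypothesis.ValiantsHypothesis.Theorems.DetQPDetqpThesis.stub_torusLimit_general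
    f P hP J hJ hJf μ ν₀ hμ

/-- **Stub B2d (TRUE) — Borel-fixed witnesses from the parts: weights (B2w) + stabiliser (B2s) +
torus limit (B2t) ⇒ B2.**  Given a witness `(P, J)` for `pp := X₀₀^{m-n} H_n(X_ι)` (orbit
sequence, `IsBorderApolarLimit`, `J ⊆ Ann(pp)`), produce one whose `J` is moreover stable under
`D ↦ Mᵀ · D` for every invertible `M ∈ H(n,m,ι)` (the four conjuncts).  How (the per-analogue is
LANDED, `Theorems/BorderApolarityBorelFixedBorderApolarity.lean`, and every step transfers):
take `μ` from B2w; (1) torus limit (B2t) makes `J` `μ`-graded; (2) DESCENT: while some `V` with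
unit diagonal and `Vᵀ ∈ H` (so `V` is `μ`-LOWERING by anti-dominance (2)(i)–(iii), `det V = 1` by
triangularity for the injective `μ`, and `A := (V⁻¹)ᵀ = (Vᵀ)⁻¹` fixes `pp` by B2s) moves `J`,
replace `J` by `in_μ(V · J)` — translate (`bfba_isBorderApolarLimit_translate`,
`bfba_linSubst_mem_glOrbit`, `apolarAction_linSubst_eq_zero_iff`) then B2t; the rank profile
`Σ_{k ≤ m} Σ_{0 ≤ ν ≤ hi} dim (J_k ∩ F_{≥ν})` strictly drops (`bfba_rank_le`,
`bfba_map_eq_of_rank_eq`, `bfba_rank_initSpan`, `bfba_lowering`), so the descent ends at a graded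
`J` stable under all such `V`; (3) W4: for an invertible `M ∈ H` the diagonal is nowhere zero
(`bfba_det_eq_prod_diag` for the order `μ`), `Mᵀ = V · diag(M)` with `V = (diag(M)⁻¹ M)ᵀ` in the
descent class, `diag(M)` preserves graded `J_k` by genericity (4) of B2w (as `bfba_torus_stable`),
and `linSubst_mul`.  [Borel1991 Thm 10.4 replaced by explicit descent; BuczynskaBuczynski2021
Thm 31; ConnerHarperLandsberg2023 §2.4] -/
theorem borelFixed_of_parts_landed (n m : ℕ) [NeZero m] (hn : 1 ≤ n) (hnm : n ≤ m)
    (ι : (Fin 4 → Fin n) → Fin m × Fin m) (hι : Function.Injective ι)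
    (hℓ : ((0 : Fin m), (0 : Fin m)) ∉ Set.range ι)
    -- B2w
    (hW : ∃ μ : Fin m × Fin m → ℤ,
      (∀ v, 0 ≤ μ v) ∧
      Function.Injective μ ∧
      (∀ I I' : Fin 4 → Fin n, (∀ r, I' r ≤ I r) → I ≠ I' → μ (ι I) < μ (ι I')) ∧
      (∀ p : Fin m × Fin m, p ∉ Set.range ι → p ≠ (0, 0) → ∀ I : Fin 4 → Fin n, μ p < μ (ι I)) ∧
      (∀ p : Fin m × Fin m, p ∉ Set.range ι → p ≠ (0, 0) → μ p < μ (0, 0)) ∧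
      (∀ p q : Fin m × Fin m, p ∉ Set.range ι → p ≠ (0, 0) → q ∉ Set.range ι → q ≠ (0, 0) →
        (p.1 : ℕ) * m + (p.2 : ℕ) < (q.1 : ℕ) * m + (q.2 : ℕ) → μ q < μ p) ∧
      (∃ ν₀ : ℤ, ∀ d ∈ (X ((0 : Fin m), (0 : Fin m)) ^ (m - n) *
          rename ι (hyperdet fun I : Fin 4 → Fin n => (X I : MvPolynomial (Fin 4 → Fin n) ℂ))).support,
        Finsupp.weight μ d = ν₀) ∧
      (∀ e e' : Fin m × Fin m →₀ ℕ, e.degree ≤ m → e'.degree ≤ m →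
        Finsupp.weight μ e = Finsupp.weight μ e' →
        ∀ d : Fin m × Fin m → ℂ, (∀ v, d v ≠ 0) →
          (∃ t : Fin 4 → Fin n → ℂ, ∀ I : Fin 4 → Fin n, d (ι I) = ∏ r, t r (I r)) →
          ∏ v ∈ e.support, d v ^ e v = ∏ v ∈ e'.support, d v ^ e' v) ∧
      (∃ hi : ℤ, ∀ e : Fin m × Fin m →₀ ℕ, e.degree ≤ m → Finsupp.weight μ e ≤ hi))
    -- B2s
    (hS : ∀ M : Matrix (Fin m × Fin m) (Fin m × Fin m) ℂ,
      (∃ a : Fin 4 → Matrix (Fin n) (Fin n) ℂ,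
        (∀ (r : Fin 4) (i j : Fin n), j < i → a r i j = 0) ∧
        (∀ I I' : Fin 4 → Fin n, M (ι I') (ι I) = ∏ r, a r (I' r) (I r)) ∧
        M (0, 0) (0, 0) ^ (m - n) * ∏ r, ∏ i, a r i i = 1) →
      (∀ (I : Fin 4 → Fin n) (p : Fin m × Fin m), p ∉ Set.range ι → M p (ι I) = 0) →
      (∀ p : Fin m × Fin m, p ≠ (0, 0) → M p (0, 0) = 0) →
      linSubst (Fin m × Fin m) ℂ M
          (X ((0 : Fin m), (0 : Fin m)) ^ (m - n) *
            rename ι (hyperdet fun I : Fin 4 → Fin n => (X I : MvPolynomial (Fin 4 → Fin n) ℂ))) =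
        X ((0 : Fin m), (0 : Fin m)) ^ (m - n) *
          rename ι (hyperdet fun I : Fin 4 → Fin n => (X I : MvPolynomial (Fin 4 → Fin n) ℂ)))
    -- B2t
    (hT : ∀ (f : MvPolynomial (Fin m × Fin m) ℂ) (P : ℕ → MvPolynomial (Fin m × Fin m) ℂ),
      (∀ t, P t ∈ glOrbit (Fin m × Fin m) ℂ (detPoly (Fin m) ℂ)) →
      ∀ J : ℕ → Set (MvPolynomial (Fin m × Fin m) ℂ), IsBorderApolarLimit m P J →
      (∀ k ≤ m, ∀ D ∈ J k, apolarAction D f = 0) →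
      ∀ (μ : Fin m × Fin m → ℤ) (ν₀ : ℤ), (∀ d ∈ f.support, Finsupp.weight μ d = ν₀) →
      ∃ (P' : ℕ → MvPolynomial (Fin m × Fin m) ℂ) (J' : ℕ → Set (MvPolynomial (Fin m × Fin m) ℂ)),
        (∀ t, P' t ∈ glOrbit (Fin m × Fin m) ℂ (detPoly (Fin m) ℂ)) ∧ IsBorderApolarLimit m P' J' ∧
        (∀ k ≤ m, ∀ D ∈ J' k, apolarAction D f = 0) ∧
        (∀ k, ∀ D, D ∈ J' k ↔ D ∈ Submodule.span ℂ {D' : MvPolynomial (Fin m × Fin m) ℂ |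
            ∃ E ∈ J k, ∃ ν : ℤ, D' = weightedHomogeneousComponent μ ν E ∧
              ∀ ν' : ℤ, ν' < ν → weightedHomogeneousComponent μ ν' E = 0}))
    -- the witness
    (h : ∃ (P : ℕ → MvPolynomial (Fin m × Fin m) ℂ) (J : ℕ → Set (MvPolynomial (Fin m × Fin m) ℂ)),
      (∀ t : ℕ, P t ∈ glOrbit (Fin m × Fin m) ℂ (detPoly (Fin m) ℂ)) ∧
      IsBorderApolarLimit m P J ∧
      (∀ k ≤ m, ∀ D ∈ J k, apolarAction D
        (X ((0 : Fin m), (0 : Fin m)) ^ (m - n) *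
          rename ι (hyperdet fun I : Fin 4 → Fin n => (X I : MvPolynomial (Fin 4 → Fin n) ℂ))) = 0)) :
    ∃ (P : ℕ → MvPolynomial (Fin m × Fin m) ℂ) (J : ℕ → Set (MvPolynomial (Fin m × Fin m) ℂ)),
      (∀ t : ℕ, P t ∈ glOrbit (Fin m × Fin m) ℂ (detPoly (Fin m) ℂ)) ∧
      IsBorderApolarLimit m P J ∧
      (∀ A : Matrix.GeneralLinearGroup (Fin m × Fin m) ℂ,
        let M : Matrix (Fin m × Fin m) (Fin m × Fin m) ℂ := A;
        (∃ a : Fin 4 → Matrix (Fin n) (Fin n) ℂ,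
            (∀ (r : Fin 4) (i j : Fin n), j < i → a r i j = 0) ∧
            (∀ I I' : Fin 4 → Fin n, M (ι I') (ι I) = ∏ r, a r (I' r) (I r)) ∧
            M (0, 0) (0, 0) ^ (m - n) * ∏ r, ∏ i, a r i i = 1) →
        (∀ (I : Fin 4 → Fin n) (p : Fin m × Fin m), p ∉ Set.range ι → M p (ι I) = 0) →
        (∀ p : Fin m × Fin m, p ≠ (0, 0) → M p (0, 0) = 0) →
        (∀ p q : Fin m × Fin m, p ∉ Set.range ι → p ≠ (0, 0) → q ∉ Set.range ι → q ≠ (0, 0) →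
            (p.1 : ℕ) * m + (p.2 : ℕ) < (q.1 : ℕ) * m + (q.2 : ℕ) → M q p = 0) →
        ∀ k ≤ m, ∀ D ∈ J k, linSubst (Fin m × Fin m) ℂ Mᵀ D ∈ J k) ∧
      (∀ k ≤ m, ∀ D ∈ J k, apolarAction D
        (X ((0 : Fin m), (0 : Fin m)) ^ (m - n) *
          rename ι (hyperdet fun I : Fin 4 → Fin n => (X I : MvPolynomial (Fin 4 → Fin n) ℂ))) = 0) :=
  Summit.ValiantsHypothesis.ValiantsHypothesis.Theorems.DetQPDetqpThesis.stub_borelFixed_of_parts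
    n m hn hnm ι hι hℓ hW hS hT h

/-- **Stub C₁ (LANDED p102403 as `Theorems.DetQPDetqpThesis.stub_borderFloor`; the polynomial part of the window) — border floor for the
four-dimensional determinant: `\underline{dc}(H_n) ≥ n⁴/2`.**  For `3 ≤ n ≤ m` with `2m < n⁴` and
every placement `ι` (injective, missing `X₀₀`), the padded four-dimensional determinant
`X₀₀^{m-n} H_n(X_ι)` is NOT in `Δ(det_m)`.  How: the Landsberg–Manivel–Ressayre invariant, PROVED
in the tree for the padded permanent (`Literature/.../BorderDcQuadraticBoundProofs.lean`:
`lmrInvariant_eq_zero_of_mem_glOrbit_detPoly` — at every zero of an element of `GL·det_m` the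
Hessian has rank `≤ 2m`, so on every line every root of `h|_L` is a root of every generalised
`(2m+1)`-minor of the Hessian; `lmrInvariant_eq_zero_of_mem_orbitClosure` — transfer to the orbit
closure; `exists_lmrInvariant_eq_one` — independence of the univariate family gives invariant `1`)
applied at the block-diagonal embedding of the Mignon–Ressayre point, where `H_n` vanishes
(`Theorems.DetQPDetqpThesis.eval_blockEmb_mrPoint_hyperdet`), its Hessian is
`((n)!·(n-3)!) •` an invertible pattern matrix (`hess0_hyperdet_blockEmb_mrPoint`,
`stub_hdPattern_mulVec_injective`, landed p89469/p90075), and along the coordinate line of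
`X_{ι(0,0,0,0)}` the padded form is `n!·(n-1)!·t` (`hyperdet_blockArr`, `eval_onesExcept_perPoly`).
This is the BORDER upgrade of the landed affine floor `n⁴ ≤ 2·dc(H_n)` and settles stub C on the
sub-window `n² + 1 ≤ m < n⁴/2` outright (no witness at all there, by witness ⇒ membership).
[LandsbergManivelRessayre2013 Thm 1.2.1 / Lemma 2.4.1; MignonRessayre2004] -/
theorem borderFloor_landed (n m : ℕ) [NeZero m] (hn : 3 ≤ n) (hnm : n ≤ m) (hlt : 2 * m < n ^ 4)
    (ι : (Fin 4 → Fin n) → Fin m × Fin m) (hι : Function.Injective ι)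
    (hℓ : ((0 : Fin m), (0 : Fin m)) ∉ Set.range ι) :
    X ((0 : Fin m), (0 : Fin m)) ^ (m - n) *
        rename ι (hyperdet fun I : Fin 4 → Fin n => (X I : MvPolynomial (Fin 4 → Fin n) ℂ)) ∉
      orbitClosure (detPoly (Fin m) ℂ) :=
  Summit.ValiantsHypothesis.ValiantsHypothesis.Theorems.DetQPDetqpThesis.stub_borderFloor n m hn hnm hlt ι hι hℓ

/-- **Stub C₂ (THE BET, hardest; research / open-problem) — no Borel-fixed border-apolar witness for
the padded four-dimensional determinant in the UPPER part of the quasi-polynomial window.**  For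
every `c` there is `n₀` such that for `n ≥ n₀`, `n⁴/2 ≤ m ≤ 2^{(log₂ n + c)^c}` and every placement
`ι` (injective, missing `X₀₀`) there is NO pair `(P, J)`: `P_t ∈ GL·det_m`, `J` the degree-wise
Kuratowski limit of `Ann(P_t)`, `J` stable under the group `H(n,m,ι)` (the four conjuncts: used
columns a Kronecker product of four upper triangular matrices, padding column scalar, unused
columns triangular, character one), and `J_k ⊆ Ann_k(X₀₀^{m-n} H_n(X_ι))` for `k ≤ m`.  Below
`n⁴/2` the statement is settled by stub C₁ (Hessian / dual-variety methods, which provably saturate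
at half the number of variables, `N/2 = n⁴/2`); from `n⁴/2` on, with B1 and B2 this is pointwise
equivalent to `X₀₀^{m-n} H_n ∉ Δ(det_m)`, i.e. to the border form of the Extended Valiant
Hypothesis for the `VNP`-complete family `H` above the Hessian range; the CONTENT is the normal
form (witness multigraded by slot contents × padding degree × unused multidegree and stable under
the four unipotent index-raising families).  Why it might fail: `\underline{dc}(H_n)` might be
quasi-polynomial (nothing excludes it), or the unipotent part of `H` might prune nothing.
[BuczynskaBuczynski2021; ConnerHarperLandsberg2023 = arXiv:1911.07981; LandsbergManivelRessayre2013;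
Gurvits2004 Ex. 3.3; BurgisserIkenmeyer2017 = arXiv:1511.02927; KadishLandsberg2014] -/
theorem stub_noFixedWitnessQP_high :
    ∀ c : ℕ, ∃ n₀ : ℕ, ∀ n ≥ n₀, ∀ (m : ℕ) [NeZero m], n ^ 4 ≤ 2 * m →
      m ≤ 2 ^ ((Nat.log 2 n + c) ^ c) →
      ∀ ι : (Fin 4 → Fin n) → Fin m × Fin m, Function.Injective ι →
        ((0 : Fin m), (0 : Fin m)) ∉ Set.range ι →
        ¬ ∃ (P : ℕ → MvPolynomial (Fin m × Fin m) ℂ) (J : ℕ → Set (MvPolynomial (Fin m × Fin m) ℂ)),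
          (∀ t : ℕ, P t ∈ glOrbit (Fin m × Fin m) ℂ (detPoly (Fin m) ℂ)) ∧
          IsBorderApolarLimit m P J ∧
          (∀ A : Matrix.GeneralLinearGroup (Fin m × Fin m) ℂ,
            let M : Matrix (Fin m × Fin m) (Fin m × Fin m) ℂ := A;
            (∃ a : Fin 4 → Matrix (Fin n) (Fin n) ℂ,
                (∀ (r : Fin 4) (i j : Fin n), j < i → a r i j = 0) ∧
                (∀ I I' : Fin 4 → Fin n, M (ι I') (ι I) = ∏ r, a r (I' r) (I r)) ∧
                M (0, 0) (0, 0) ^ (m - n) * ∏ r, ∏ i, a r i i = 1) →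
            (∀ (I : Fin 4 → Fin n) (p : Fin m × Fin m), p ∉ Set.range ι → M p (ι I) = 0) →
            (∀ p : Fin m × Fin m, p ≠ (0, 0) → M p (0, 0) = 0) →
            (∀ p q : Fin m × Fin m, p ∉ Set.range ι → p ≠ (0, 0) → q ∉ Set.range ι → q ≠ (0, 0) →
                (p.1 : ℕ) * m + (p.2 : ℕ) < (q.1 : ℕ) * m + (q.2 : ℕ) → M q p = 0) →
            ∀ k ≤ m, ∀ D ∈ J k, linSubst (Fin m × Fin m) ℂ Mᵀ D ∈ J k) ∧
          (∀ k ≤ m, ∀ D ∈ J k, apolarAction D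
            (X ((0 : Fin m), (0 : Fin m)) ^ (m - n) *
              rename ι (hyperdet fun I : Fin 4 → Fin n => (X I : MvPolynomial (Fin 4 → Fin n) ℂ))) = 0) := by
  sorry

/-! ## Proved glue, part 0: B2 (Borel-fixed witnesses) from B2w + B2s + B2t + B2d -/

/-- **B2 — Borel-fixed witnesses for the padded four-dimensional determinant** (the crux-plan's
stub B2, now derived): if SOME border-apolar witness `(P, J)` with `J ⊆ Ann(pp)` exists for
`pp = X₀₀^{m-n}·H_n(X_ι)`, then one exists with `J` moreover `H(n,m,ι)`-stable. -/
theorem borelFixedWitness (n m : ℕ) [NeZero m] (hn : 1 ≤ n) (hnm : n ≤ m)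
    (ι : (Fin 4 → Fin n) → Fin m × Fin m) (hι : Function.Injective ι)
    (hℓ : ((0 : Fin m), (0 : Fin m)) ∉ Set.range ι)
    (h : ∃ (P : ℕ → MvPolynomial (Fin m × Fin m) ℂ) (J : ℕ → Set (MvPolynomial (Fin m × Fin m) ℂ)),
      (∀ t : ℕ, P t ∈ glOrbit (Fin m × Fin m) ℂ (detPoly (Fin m) ℂ)) ∧
      IsBorderApolarLimit m P J ∧
      (∀ k ≤ m, ∀ D ∈ J k, apolarAction D
        (X ((0 : Fin m), (0 : Fin m)) ^ (m - n) *
          rename ι (hyperdet fun I : Fin 4 → Fin n => (X I : MvPolynomial (Fin 4 → Fin n) ℂ))) = 0)) :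
    ∃ (P : ℕ → MvPolynomial (Fin m × Fin m) ℂ) (J : ℕ → Set (MvPolynomial (Fin m × Fin m) ℂ)),
      (∀ t : ℕ, P t ∈ glOrbit (Fin m × Fin m) ℂ (detPoly (Fin m) ℂ)) ∧
      IsBorderApolarLimit m P J ∧
      (∀ A : Matrix.GeneralLinearGroup (Fin m × Fin m) ℂ,
        let M : Matrix (Fin m × Fin m) (Fin m × Fin m) ℂ := A;
        (∃ a : Fin 4 → Matrix (Fin n) (Fin n) ℂ,
            (∀ (r : Fin 4) (i j : Fin n), j < i → a r i j = 0) ∧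
            (∀ I I' : Fin 4 → Fin n, M (ι I') (ι I) = ∏ r, a r (I' r) (I r)) ∧
            M (0, 0) (0, 0) ^ (m - n) * ∏ r, ∏ i, a r i i = 1) →
        (∀ (I : Fin 4 → Fin n) (p : Fin m × Fin m), p ∉ Set.range ι → M p (ι I) = 0) →
        (∀ p : Fin m × Fin m, p ≠ (0, 0) → M p (0, 0) = 0) →
        (∀ p q : Fin m × Fin m, p ∉ Set.range ι → p ≠ (0, 0) → q ∉ Set.range ι → q ≠ (0, 0) →
            (p.1 : ℕ) * m + (p.2 : ℕ) < (q.1 : ℕ) * m + (q.2 : ℕ) → M q p = 0) →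
        ∀ k ≤ m, ∀ D ∈ J k, linSubst (Fin m × Fin m) ℂ Mᵀ D ∈ J k) ∧
      (∀ k ≤ m, ∀ D ∈ J k, apolarAction D
        (X ((0 : Fin m), (0 : Fin m)) ^ (m - n) *
          rename ι (hyperdet fun I : Fin 4 → Fin n => (X I : MvPolynomial (Fin 4 → Fin n) ℂ))) = 0) :=
  borelFixed_of_parts_landed n m hn hnm ι hι hℓ (weightH_landed n m ι hι hℓ)
    (fun M h1 h2 h3 => stabH_landed n m ι hι hℓ M h1 h2 h3)
    (fun f P hP J hJ hJf μ ν₀ hμ => torusLimit_general_landed f P hP J hJ hJf μ ν₀ hμ) h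

/-! ## Proved glue, part 1: the border engine gives `X_H` -/

/-- The four-dimensional determinant of the generic array (abbreviation used in proofs only; the
stubs spell it out). -/
abbrev hd4 (n : ℕ) : MvPolynomial (Fin 4 → Fin n) ℂ :=
  hyperdet fun I : Fin 4 → Fin n => (X I : MvPolynomial (Fin 4 → Fin n) ℂ)

/-- **B1 + B2 + C: in the quasi-polynomial window the padded four-dimensional determinant is not a
degeneration of the determinant.** -/
theorem hyperdet_not_mem_orbitClosure_qp (c : ℕ) :
    ∃ n₀ : ℕ, ∀ n ≥ n₀, ∀ (m : ℕ) [NeZero m], n ^ 2 + 1 ≤ m → m ≤ 2 ^ ((Nat.log 2 n + c) ^ c) →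
      ∀ ι : (Fin 4 → Fin n) → Fin m × Fin m, Function.Injective ι →
        ((0 : Fin m), (0 : Fin m)) ∉ Set.range ι →
        X ((0 : Fin m), (0 : Fin m)) ^ (m - n) * rename ι (hd4 n) ∉ orbitClosure (detPoly (Fin m) ℂ) := by
  obtain ⟨n₀, hn₀⟩ := stub_noFixedWitnessQP_high c
  refine ⟨max n₀ 3, fun n hn m _ hm hmc ι hι hℓ hmem => ?_⟩
  have hn3 : 3 ≤ n := le_of_max_le_right hn
  have hnn₀ : n₀ ≤ n := le_of_max_le_left hn
  have hnm : n ≤ m := by nlinarith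
  by_cases hlt : 2 * m < n ^ 4
  · -- the polynomial part of the window: Hessian border floor (stub C₁)
    exact borderFloor_landed n m hn3 hnm hlt ι hι hℓ hmem
  · -- the upper part: B1 + B2 + C₂
    have hge : n ^ 4 ≤ 2 * m := not_lt.1 hlt
    obtain ⟨P, J, hP, hJ, hcont⟩ := sequentialApolarity_landed _ hmem
    have hfix := borelFixedWitness n m (by omega) hnm ι hι hℓ ⟨P, J, hP, hJ, hcont⟩
    exact hn₀ n hnn₀ m hge hmc ι hι hℓ hfix

/-- `H_n` is a form of degree `n`. -/
theorem hd4_isHomogeneous (n : ℕ) : (hd4 n).IsHomogeneous n := by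
  unfold hd4 hyperdet
  apply IsHomogeneous.sum
  intro σ _
  have hsign : (∏ j, ((Equiv.Perm.sign (σ j) : ℤ) : MvPolynomial (Fin 4 → Fin n) ℂ)).IsHomogeneous 0 := by
    rw [← Int.cast_prod, ← map_intCast (C : ℂ →+* MvPolynomial (Fin 4 → Fin n) ℂ)]
    exact isHomogeneous_C _ _
  have hprod : (∏ i : Fin n, (X (fun j => σ j i) : MvPolynomial (Fin 4 → Fin n) ℂ)).IsHomogeneous n := by
    have := IsHomogeneous.prod (Finset.univ : Finset (Fin n))
      (fun i => (X (fun j => σ j i) : MvPolynomial (Fin 4 → Fin n) ℂ)) (fun _ => 1)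
      (fun i _ => isHomogeneous_X ℂ _)
    simpa using this
  simpa using hsign.mul hprod

/-- Existence of a placement of the `n⁴` array variables among the `m²` matrix variables missing
`X₀₀`, as soon as `n² + 1 ≤ m`. -/
theorem exists_placement {n m : ℕ} [NeZero m] (h : n ^ 2 + 1 ≤ m) :
    ∃ ι : (Fin 4 → Fin n) → Fin m × Fin m, Function.Injective ι ∧
      ((0 : Fin m), (0 : Fin m)) ∉ Set.range ι := by
  have hcard : Fintype.card (Option (Fin 4 → Fin n)) ≤ Fintype.card (Fin m × Fin m) := by
    simp only [Fintype.card_option, Fintype.card_fun, Fintype.card_fin, Fintype.card_prod]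
    nlinarith
  obtain ⟨e⟩ := Function.Embedding.nonempty_of_card_le hcard
  let e' : Option (Fin 4 → Fin n) ↪ Fin m × Fin m :=
    e.trans (Equiv.swap (e none) ((0 : Fin m), (0 : Fin m))).toEmbedding
  have he' : e' none = ((0 : Fin m), (0 : Fin m)) := by
    simp [e', Function.Embedding.trans_apply, Equiv.swap_apply_left]
  refine ⟨fun I => e' (some I), fun I I' hII' => Option.some_injective _ (e'.injective hII'), ?_⟩
  rintro ⟨I, hI⟩
  exact Option.some_ne_none I (e'.injective (hI.trans he'.symm))

/-- The qp template is monotone in its constant. -/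
theorem qpBound_mono {c c' : ℕ} (h : c ≤ c') (n : ℕ) :
    2 ^ ((Nat.log 2 n + c) ^ c) ≤ 2 ^ ((Nat.log 2 n + c') ^ c') := by
  apply Nat.pow_le_pow_right (by norm_num)
  rcases Nat.eq_zero_or_pos (Nat.log 2 n + c') with h0 | hpos
  · have hc' : c' = 0 := by omega
    have hc : c = 0 := by omega
    subst hc' hc
    exact le_rfl
  · calc (Nat.log 2 n + c) ^ c ≤ (Nat.log 2 n + c') ^ c := Nat.pow_le_pow_left (by omega) _
      _ ≤ (Nat.log 2 n + c') ^ c' := Nat.pow_le_pow_right hpos h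

/-- The window is non-empty: `n² + 1 ≤ 2^{(log₂ n + c)^c}` for `c ≥ 2`. -/
theorem sq_succ_le_qpBound {c : ℕ} (hc : 2 ≤ c) (n : ℕ) : n ^ 2 + 1 ≤ 2 ^ ((Nat.log 2 n + c) ^ c) := by
  have hlt : n < 2 ^ (Nat.log 2 n + 1) := Nat.lt_pow_succ_log_self Nat.one_lt_two n
  have h1 : n ^ 2 < (2 ^ (Nat.log 2 n + 1)) ^ 2 := Nat.pow_lt_pow_left hlt (by norm_num)
  have h2 : (2 ^ (Nat.log 2 n + 1)) ^ 2 ≤ 2 ^ ((Nat.log 2 n + 2) ^ 2) := by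
    rw [← pow_mul]
    exact Nat.pow_le_pow_right (by norm_num) (by nlinarith)
  have h3 := qpBound_mono hc n
  omega

/-- **`X_H`: the determinantal complexity of the four-dimensional determinant is not
quasi-polynomially bounded** (from B1, B2, C through the tree's PROVED homogenisation lemma
`X_pow_mul_rename_mem_endOrbit_detPoly` — an affine determinantal expression of size `≤ m` puts the
padded form into `End·det_m ⊆ Δ(det_m)`). -/
theorem not_isQPBounded_dc_hyperdet :
    ¬ IsQPBounded (fun n => determinantalComplexity (hd4 n)) := by
  rintro ⟨c, hc⟩
  obtain ⟨n₀, hn₀⟩ := hyperdet_not_mem_orbitClosure_qp (max c 2)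
  set n := n₀ with hn
  set m := 2 ^ ((Nat.log 2 n + max c 2) ^ max c 2) with hm
  have hwin : n ^ 2 + 1 ≤ m := sq_succ_le_qpBound (le_max_right c 2) n
  haveI : NeZero m := NeZero.of_pos (by omega)
  have hnm : n ≤ m := by nlinarith
  obtain ⟨ι, hι, hℓ⟩ := exists_placement (n := n) (m := m) hwin
  have hdc : determinantalComplexity (hd4 n) ≤ m :=
    (hc n).trans (qpBound_mono (le_max_left c 2) n)
  have hrepr : HasDetRepr (hd4 n) m :=
    HasDetRepr.mono_holds (hasDetRepr_determinantalComplexity_holds (hd4 n)) hdc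
  have hmem : X ((0 : Fin m), (0 : Fin m)) ^ (m - n) * rename ι (hd4 n) ∈
      orbitClosure (detPoly (Fin m) ℂ) :=
    endOrbit_subset_orbitClosure_holds _
      (X_pow_mul_rename_mem_endOrbit_detPoly (hd4_isHomogeneous n) hnm hrepr ι _)
  exact hn₀ n le_rfl m hwin le_rfl ι hι hℓ hmem

/-! ## Proved glue, part 2: the transfer `X_H → X` (stub A + Valiant completeness) -/

/-- qp ∘ poly = qp: a qp bound at a p-bounded argument is a qp bound. -/
theorem qpBound_comp_le {t : ℕ → ℕ} (ht : IsPBounded t) (c : ℕ) :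
    ∃ c' : ℕ, ∀ n, 2 ^ ((Nat.log 2 (t n) + c) ^ c) ≤ 2 ^ ((Nat.log 2 n + c') ^ c') := by
  obtain ⟨A, hA1, hA⟩ := IsPBounded.exists_lt_two_pow ht
  refine ⟨A + 2 * c + 1, fun n => Nat.pow_le_pow_right (by norm_num) ?_⟩
  have hlog : Nat.log 2 (t n) < (Nat.log 2 n + 1) * A := by
    rcases Nat.eq_zero_or_pos (t n) with h0 | h0
    · rw [h0, Nat.log_zero_right]
      exact Nat.mul_pos (by omega) (by omega)
    · exact Nat.log_lt_of_lt_pow (by omega) (hA n)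
  have h1 : Nat.log 2 (t n) + c ≤ (Nat.log 2 n + 1) * (A + c) := by nlinarith
  calc (Nat.log 2 (t n) + c) ^ c ≤ ((Nat.log 2 n + 1) * (A + c)) ^ c := Nat.pow_le_pow_left h1 _
    _ = (Nat.log 2 n + 1) ^ c * (A + c) ^ c := by rw [mul_pow]
    _ ≤ (Nat.log 2 n + (A + 2 * c + 1)) ^ c * (Nat.log 2 n + (A + 2 * c + 1)) ^ c :=
        Nat.mul_le_mul (Nat.pow_le_pow_left (by omega) _) (Nat.pow_le_pow_left (by omega) _)
    _ = (Nat.log 2 n + (A + 2 * c + 1)) ^ (2 * c) := by rw [← pow_add]; ring_nf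
    _ ≤ (Nat.log 2 n + (A + 2 * c + 1)) ^ (A + 2 * c + 1) :=
        Nat.pow_le_pow_right (by omega) (by omega)

/-- Renaming is a projection (substitute `X (φ i)` for `X i`). -/
theorem isProjection_rename {σ τ : Type*} (φ : σ → τ) (f : MvPolynomial σ ℂ) :
    IsProjection (rename φ f) f :=
  have h : (rename φ : MvPolynomial σ ℂ →ₐ[ℂ] MvPolynomial τ ℂ) = aeval fun i => X (φ i) :=
    MvPolynomial.algHom_ext fun i => by simp
  ⟨fun i => X (φ i), fun i => Or.inl ⟨φ i, rfl⟩, DFunLike.congr_fun h f⟩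

/-- **Transfer (stub A ⇒ `X_H → X`).**  `H ∈ VNP` and the `VNP`-completeness of the permanent over `ℂ`
(PROVED in tree) make `H_n` a projection of `per_{t(n)}` with `t` p-bounded, so `dc(H_n) ≤ dc(per_{t(n)})`
(`determinantalComplexity_le_of_isProjection_holds`) and a qp bound for `per` is one for `H`. -/
theorem detqpThesis_of_transfer
    (hA : IsVNPFamily (k := ℂ)
      (fun n => hyperdet fun I : Fin 4 → Fin n => (X I : MvPolynomial (Fin 4 → Fin n) ℂ)))
    (hX : ¬ IsQPBounded (fun n => determinantalComplexity (hd4 n))) :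
    Summit.ValiantsHypothesis.ValiantsHypothesis.Theses.DetQP.DetqpThesis := by
  change ¬ IsQPBounded (fun n => determinantalComplexity (perPoly (Fin n) ℂ))
  rintro ⟨c, hc⟩
  apply hX
  -- bundle `H` along `Fin`-valued variables and apply completeness
  set e : ∀ n, (Fin 4 → Fin n) ≃ Fin (Fintype.card (Fin 4 → Fin n)) := fun n => Fintype.equivFin _
  have hg : IsVNPFamily (k := ℂ) (fun n => renameEquiv ℂ (e n) (hd4 n)) :=
    (isVNPFamily_renameEquiv_iff e _).2 hA
  have h2 : ringChar ℂ ≠ 2 := by rw [ringChar.eq_zero]; decide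
  obtain ⟨t, ht, hproj⟩ := (isVNPComplete_perPoly_holds ℂ h2).2 _ _ hg
  obtain ⟨c', hc'⟩ := qpBound_comp_le ht c
  refine ⟨c', fun n => ?_⟩
  show determinantalComplexity (hd4 n) ≤ _
  have hback : IsProjection (hd4 n) (renameEquiv ℂ (e n) (hd4 n)) := by
    have := isProjection_rename (e n).symm (renameEquiv ℂ (e n) (hd4 n))
    simpa [MvPolynomial.renameEquiv_apply, MvPolynomial.rename_rename, MvPolynomial.rename_id_apply] using this
  calc determinantalComplexity (hd4 n)
      ≤ determinantalComplexity (renameEquiv ℂ (e n) (hd4 n)) :=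
        determinantalComplexity_le_of_isProjection_holds hback
    _ ≤ determinantalComplexity (perPoly (Fin (t n)) ℂ) :=
        determinantalComplexity_le_of_isProjection_holds (hproj n)
    _ ≤ 2 ^ ((Nat.log 2 (t n) + c) ^ c) := hc (t n)
    _ ≤ 2 ^ ((Nat.log 2 n + c') ^ c') := hc' n

/-! ## The skeleton theorems -/

/-- **The crux BY NAME from the stubs** (`sorry` only inside `stub_*`):
`DetQP.DetqpThesis` (= `UlrichPadded.Target` = `ScaledPencil.DcPerNotQP`, the same term). -/
theorem DetqpThesis_of : Summit.ValiantsHypothesis.ValiantsHypothesis.Theses.DetQP.DetqpThesis :=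
  detqpThesis_of_transfer hyperdet_isVNP not_isQPBounded_dc_hyperdet

/-- The same term under its UlrichPadded name (the route this lead is seated on). -/
theorem Target_of : Summit.ValiantsHypothesis.ValiantsHypothesis.Theses.UlrichPadded.Target :=
  DetqpThesis_of

end

end Summit.ValiantsHypothesis.ValiantsHypothesis.Cruxes.DetqpThesis.FourDimensionalDeterminant
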